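import Mathlib
import HarnessLib
import Summits.HubbardSuperconductivity.HubbardSuperconductivity.Theorems.ChiralWindowCwKLChiralWindowChannelBoundX
import Summits.HubbardSuperconductivity.HubbardSuperconductivity.Theorems.ChiralWindowCwKLChiralWindowNodeBoundS
import Literature.Analysis.OperatorTheory.CompactCompression
import Literature.Analysis.OperatorTheory.CompactSelfAdjointEigenbasis
import Literature.Analysis.OperatorTheory.EigenvectorSpan
import Literature.MathematicalPhysics.QuantumLattice.KohnLuttingerChannelStates

/-!
# Crux `CwKLChiralWindow` (stmt-1741), line `Sketch`: pointwise amplitude bounds for `E` bottom states from the `E_x` BLOCK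

`stub_klNodeBoundX`: the `E`-branch of `stub_klNodeBoundS` (`…NodeBoundS`) rebuilt on the `E_x`-block package `kl_cbx_setup`
(`…ChannelBoundX`).  In the setting of `stub_klChannelBoundX` (plain kernel `χ₀(k+k')`, reflection-even `E`-channel trial `Φ`,
rotation-invariant deflation, enclosures `ρlo N ≤ Q ≤ ρhi N`, `ρhi < 0`, `∫ (∫ χ₀ Φ - s Φ)² ≤ et N`, `H ≤ h`, `β ≤ 0`,
`h/2 - ρhi² ≤ β²`, `ρhi < β`), with a row bound on the SECTOR kernel `∫ (d4Project E (χ₀(k + ·)))² ≤ R2` a.e. and the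
simplicity condition `h < 4ρhi²`, every `E` channel state `ψ` attaining the bottom obeys a.e.
`|F_Φ(k)|, |F_Φ(rot³k)| ≤ √N (|L| √(ψ(k)² + ψ(rot k)²) + √R2 √e)`, `F_Φ = ∫ χ₀(k+k') Φ(k')`, `L = min g(ρlo) g(ρhi)`,
`g(ρ) = (βρ - ρ² - et)/(β - ρ)`, `e = et/(β - ρhi)²`.

Proof.  The Rayleigh bound `≥ l` exported by `kl_cbx_setup` on the whole `E` sector `V_E = {P v = v}` makes `l` the bottom of
the compression of `A` to `V_E`, so `channelInf = l` and bottom states are `l`-eigenvectors (`kl_nb_bottom_eigvec`).  On the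
block `V = {P v = v, S v = v}` the `l`-eigenspace of the compression `T` is the line through a unit eigenvector `v₀` (an
orthonormal pair would have mass `2ρhi² ≤ h/2`, `Literature…EigenvectorSpan`), whence every `l`-eigenvector `w` of `A` in the
sector lies in the plane of the orthonormal pair `v₀, U₁ v₀` (`kl_nbx_span`: `w = ½(w + Sw) + U₃ U₁ ½(w - Sw)` with both
`½(w + Sw)` and `U₁ ½(w - Sw)` in the block).  For the bottom state, `[ψ] = α v₀ + β U₁ v₀` with `α² + β² = 1`, so
`v₀ = α [ψ] - β U₁ [ψ]`; Kato's vector (upgraded to the orthogonal projection of the trial `x` onto the eigenline) is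
`a [ψ] + b U₁ [ψ]` with `a² + b² ≤ 1`, the remainder lies in the block, hence in the sector, and is controlled by the sector
rows (`kl_nbs_remainder_ae`); the pointwise estimate and its transport along `rot³` are those of `stub_klNodeBoundS`. -/

noncomputable section

set_option linter.dupNamespace false

namespace Summit.HubbardSuperconductivity.HubbardSuperconductivity.Theorems

open MeasureTheory Literature.MathematicalPhysics.QuantumLattice Literature.Analysis.OperatorTheory

/-! ### The doublet plane of a simple block eigenvalue -/

/-- **The sector eigenspace over a simple block eigenvalue is the doublet plane.** In a real inner product space let `A`
commute with the symmetric involution `S` and with the isometry `U₁`, `P` commute with both, `S U₁ = U₃ S`, `U₃ U₁ = 1` and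
`U₃ v = -U₁ v` on the fixed space of `P`.  If every `P`- and `S`-fixed `l`-eigenvector of `A` is a multiple of `v₀`
(`P v₀ = v₀`), then every `P`-fixed `l`-eigenvector `w` of `A` lies in the plane of `v₀, U₁ v₀`: `w = ½(w + Sw) + ½(w - Sw)`,
`½(w + Sw)` and `U₁ ½(w - Sw)` are `P`- and `S`-fixed `l`-eigenvectors (`kl_cbx_decomp`), and `½(w - Sw) = U₃ U₁ ½(w - Sw)`.
[folklore] -/
theorem kl_nbx_span {H : Type*} [NormedAddCommGroup H] [InnerProductSpace ℝ H]
    {A P S U₁ U₃ : H →L[ℝ] H}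
    (hAS : A * S = S * A) (hAU : A * U₁ = U₁ * A) (hPS : S * P = P * S) (hPU : P * U₁ = U₁ * P)
    (hSS : S * S = 1) (hSsym : ∀ φ ψ, inner ℝ (S φ) ψ = inner ℝ φ (S ψ))
    (hSU : S * U₁ = U₃ * S) (hUinner : ∀ φ ψ, inner ℝ (U₁ φ) (U₁ ψ) = inner ℝ φ ψ)
    (hU₃ : ∀ v, P v = v → U₃ v = -U₁ v) (h31 : U₃ * U₁ = 1) {l : ℝ} {v₀ : H} (hPv₀ : P v₀ = v₀)
    (hsimple : ∀ y, P y = y → S y = y → A y = l • y → ∃ c : ℝ, y = c • v₀)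
    {w : H} (hPw : P w = w) (hAw : A w = l • w) :
    ∃ a b : ℝ, w = a • v₀ + b • U₁ v₀ := by
  obtain ⟨⟨hPp, hSp⟩, ⟨hPq, hSq⟩, -, -⟩ := kl_cbx_decomp hAS hAU hPS hPU hSS hSsym hSU hUinner hU₃ hPw
  have hSA : ∀ y, A (S y) = S (A y) := fun y => by rw [← mul_apply_eq_comp, hAS, mul_apply_eq_comp]
  have hAp : A ((1 / 2 : ℝ) • (w + S w)) = l • ((1 / 2 : ℝ) • (w + S w)) := by
    rw [map_smul, map_add, hSA, hAw, map_smul, ← smul_add, smul_comm]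
  have hAq' : A ((1 / 2 : ℝ) • (w - S w)) = l • ((1 / 2 : ℝ) • (w - S w)) := by
    rw [map_smul, map_sub, hSA, hAw, map_smul, ← smul_sub, smul_comm]
  have hAq : A (U₁ ((1 / 2 : ℝ) • (w - S w))) = l • U₁ ((1 / 2 : ℝ) • (w - S w)) := by
    rw [← mul_apply_eq_comp, hAU, mul_apply_eq_comp, hAq', map_smul]
  obtain ⟨a, ha⟩ := hsimple _ hPp hSp hAp
  obtain ⟨c, hc⟩ := hsimple _ hPq hSq hAq
  have hq : (1 / 2 : ℝ) • (w - S w) = (-c) • U₁ v₀ := by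
    calc (1 / 2 : ℝ) • (w - S w) = (U₃ * U₁) ((1 / 2 : ℝ) • (w - S w)) := by rw [h31, one_apply_eq_self]
      _ = U₃ (c • v₀) := by rw [mul_apply_eq_comp, hc]
      _ = (-c) • U₁ v₀ := by rw [map_smul, hU₃ v₀ hPv₀, smul_neg, neg_smul]
  refine ⟨a, -c, ?_⟩
  calc w = (1 / 2 : ℝ) • (w + S w) + (1 / 2 : ℝ) • (w - S w) := by module
    _ = a • v₀ + (-c) • U₁ v₀ := by rw [ha, hq]

/-! ### Node covering from the `E_x` block -/

set_option maxHeartbeats 400000 in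
/-- **Pointwise amplitude bounds for `E` bottom states from the `E_x` block** (`stub_klNodeBoundX`). In the setting of
`stub_klChannelBoundX` (plain kernel, reflection-even `E`-channel trial `Φ`, rotation-invariant deflation, certified
enclosures with the residual bound `∫ (∫ χ₀ Φ - s Φ)² ≤ et ∫ Φ²` and `h/2 - ρhi² ≤ β²`), with a row bound on the SECTOR kernel
`∫ (d4Project E (χ₀(k + ·)))² ≤ R2` a.e. and the simplicity condition `h < 4ρhi²`: every `E` channel state `ψ` attaining the
bottom controls the trial amplitude `F_Φ(k) = ∫ χ₀(k+k') Φ(k') dσ` pointwise a.e.,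
`|F_Φ(k)|, |F_Φ(rot³k)| ≤ √N (|L| √(ψ(k)² + ψ(rot k)²) + √R2 √e)` with `L = min g(ρlo) g(ρhi)`, `g(ρ) = (βρ - ρ² - et)/(β - ρ)`
the residual Temple bound and `e = et/(β - ρhi)²` Kato's residual distance bound (the bottom is the simple block eigenvalue
`l`; bottom states are eigenvectors; the sector eigenspace is the doublet plane through `[ψ], [ψ∘rot]`; the normalised trial is
within `√e` of it; the remainder lies in the sector and is controlled row-wise by Cauchy–Schwarz). [folklore] -/
theorem stub_klNodeBoundX : ∀ μ ∈ Set.Ioo (-4 : ℝ) 0, ∀ (M : ℕ) (c : Fin M → ℝ) (u : Fin M → Momentum → ℝ)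
    (Φ : Momentum → ℝ) (ρlo ρhi et h β s R2 : ℝ),
    (∀ m, 0 ≤ c m) → (∀ m, MemLp (u m) 2 (fermiCurveMeasure (squareDispersion 1 0) μ)) →
    MemLp Φ 2 (fermiCurveMeasure (squareDispersion 1 0) μ) → InChannel D4Irrep.E Φ →
    (∀ k, Φ (reflMomentum k) = Φ k) →
    (∀ k k', ∑ m, c m * (u m (rotMomentum k) * u m (rotMomentum k')) = ∑ m, c m * (u m k * u m k')) →
    0 < ∫ k, Φ k ^ 2 ∂fermiCurveMeasure (squareDispersion 1 0) μ →
    ρlo * ∫ k, Φ k ^ 2 ∂fermiCurveMeasure (squareDispersion 1 0) μ ≤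
      ∫ k, Φ k * ∫ k', lindhardFunction (squareDispersion 1 0) μ (k + k') * Φ k'
        ∂fermiCurveMeasure (squareDispersion 1 0) μ ∂fermiCurveMeasure (squareDispersion 1 0) μ →
    ∫ k, Φ k * ∫ k', lindhardFunction (squareDispersion 1 0) μ (k + k') * Φ k'
        ∂fermiCurveMeasure (squareDispersion 1 0) μ ∂fermiCurveMeasure (squareDispersion 1 0) μ ≤
      ρhi * ∫ k, Φ k ^ 2 ∂fermiCurveMeasure (squareDispersion 1 0) μ →
    ρhi < 0 →
    ∫ k, (∫ k', lindhardFunction (squareDispersion 1 0) μ (k + k') * Φ k'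
        ∂fermiCurveMeasure (squareDispersion 1 0) μ - s * Φ k) ^ 2 ∂fermiCurveMeasure (squareDispersion 1 0) μ ≤
      et * ∫ k, Φ k ^ 2 ∂fermiCurveMeasure (squareDispersion 1 0) μ →
    ∫ z, (d4Project D4Irrep.E (fun q => lindhardFunction (squareDispersion 1 0) μ (z.1 + q)) z.2 -
        ∑ m, c m * (u m z.1 * u m z.2)) ^ 2
        ∂(fermiCurveMeasure (squareDispersion 1 0) μ).prod (fermiCurveMeasure (squareDispersion 1 0) μ) ≤ h →
    β ≤ 0 → h / 2 - ρhi ^ 2 ≤ β ^ 2 → ρhi < β →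
    0 ≤ R2 →
    (∀ᵐ k ∂fermiCurveMeasure (squareDispersion 1 0) μ, ∫ k', (d4Project D4Irrep.E (fun q =>
        lindhardFunction (squareDispersion 1 0) μ (k + q)) k') ^ 2 ∂fermiCurveMeasure (squareDispersion 1 0) μ ≤ R2) →
    h < 4 * ρhi ^ 2 →
    ∀ ψ : Momentum → ℝ, IsChannelState (squareDispersion 1 0) μ D4Irrep.E ψ →
      pairingForm (squareDispersion 1 0) μ 1 ψ = channelInf (squareDispersion 1 0) μ 1 D4Irrep.E →
      ∀ᵐ k ∂fermiCurveMeasure (squareDispersion 1 0) μ,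
        |∫ k', lindhardFunction (squareDispersion 1 0) μ (k + k') * Φ k'
            ∂fermiCurveMeasure (squareDispersion 1 0) μ| ≤
          Real.sqrt (∫ k, Φ k ^ 2 ∂fermiCurveMeasure (squareDispersion 1 0) μ) *
            (|min ((β * ρlo - ρlo ^ 2 - et) / (β - ρlo)) ((β * ρhi - ρhi ^ 2 - et) / (β - ρhi))| * Real.sqrt (ψ k ^ 2 + ψ (rotMomentum k) ^ 2) +
              Real.sqrt R2 * Real.sqrt (et / (β - ρhi) ^ 2)) ∧
        |∫ k', lindhardFunction (squareDispersion 1 0) μ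
              (rotMomentum (rotMomentum (rotMomentum k)) + k') * Φ k' ∂fermiCurveMeasure (squareDispersion 1 0) μ| ≤
          Real.sqrt (∫ k, Φ k ^ 2 ∂fermiCurveMeasure (squareDispersion 1 0) μ) *
            (|min ((β * ρlo - ρlo ^ 2 - et) / (β - ρlo)) ((β * ρhi - ρhi ^ 2 - et) / (β - ρhi))| * Real.sqrt (ψ k ^ 2 + ψ (rotMomentum k) ^ 2) +
              Real.sqrt R2 * Real.sqrt (et / (β - ρhi) ^ 2))
 := by
  intro μ hμ M c u Φ ρlo ρhi et h β s R2 hc hu hΦ hΦch hΦrefl hDrot hN hρlo hρhi hρhi0 hres hH hβ0 hβ hρβ hR2 hR hmul ψ hψs hbot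
  haveI : IsFiniteMeasure (fermiCurveMeasure (squareDispersion 1 0) μ) :=
    stub_klFiniteMeasure stub_klGradient stub_klHausdorffFinite μ hμ
  obtain ⟨A, P, S, U₁, U₃, V, T, x, l, hmemV, hVc, hA, hAinner, hAsa, hAc, hAP, -, -, -, -, hPfix, hPrepr, hU₁ae, hAU, hPU,
    hUinner, -, -, -, h31, hskew, hrot2, hneg, -, hSS, hAS, hSP, hSsym, hSU, hT, hxnorm, hxdef, hl, hlρ, hLl, -, -, hkato,
    hmass, hrayE⟩ :=
    kl_cbx_setup hμ hu hc hΦ hΦch hΦrefl hDrot hN hρlo hρhi hρhi0 hres hH hβ0 hβ hρβ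
  haveI : CompleteSpace V := hVc
  -- a unit bottom eigenvector `v₀` of the block; the block eigenvalue is simple
  obtain ⟨v₁, hv₁, hTv₁⟩ := hl
  have hv₁n : ‖v₁‖ ≠ 0 := norm_ne_zero_iff.2 hv₁
  obtain ⟨v₀, hv₀norm, hTv₀⟩ : ∃ v₀ : V, ‖v₀‖ = 1 ∧ T v₀ = l • v₀ :=
    ⟨(‖v₁‖⁻¹ : ℝ) • v₁, by rw [norm_smul, Real.norm_eq_abs, abs_of_pos (inv_pos.2 ((norm_nonneg _).lt_of_ne hv₁n.symm)),
      inv_mul_cancel₀ hv₁n], by rw [map_smul, hTv₁, smul_comm]⟩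
  have hPv₀ : P (v₀ : Lp ℝ 2 (fermiCurveMeasure (squareDispersion 1 0) μ)) = v₀ := ((hmemV _).1 v₀.2).1
  have hAv₀ : A (v₀ : Lp ℝ 2 (fermiCurveMeasure (squareDispersion 1 0) μ)) =
      l • (v₀ : Lp ℝ 2 (fermiCurveMeasure (squareDispersion 1 0) μ)) := by rw [← hT, hTv₀, Submodule.coe_smul]
  have hv₀n : ‖(v₀ : Lp ℝ 2 (fermiCurveMeasure (squareDispersion 1 0) μ))‖ = 1 := by rw [Submodule.norm_coe]; exact hv₀norm
  have hno : ∀ f : Fin 2 → V, Orthonormal ℝ f → (∀ j, T (f j) = l • f j) → False := by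
    intro f hf heigf
    have h1 := hmass 2 f hf heigf
    push_cast at h1
    linarith
  have hsimpleV : ∀ y : V, T y = l • y → y = (inner ℝ v₀ y) • v₀ := fun y hy =>
    eq_smul_of_no_orthonormal_pair T l hv₀norm hTv₀ hno hy
  have hsimple : ∀ y : Lp ℝ 2 (fermiCurveMeasure (squareDispersion 1 0) μ), P y = y → S y = y → A y = l • y →
      ∃ c' : ℝ, y = c' • (v₀ : Lp ℝ 2 (fermiCurveMeasure (squareDispersion 1 0) μ)) := by
    intro y hPy hSy hAy
    have hyV : y ∈ V := (hmemV y).2 ⟨hPy, hSy⟩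
    have hTy : T ⟨y, hyV⟩ = l • ⟨y, hyV⟩ := Subtype.ext (by rw [hT, Submodule.coe_smul]; exact hAy)
    have h1 := hsimpleV ⟨y, hyV⟩ hTy
    exact ⟨inner ℝ v₀ ⟨y, hyV⟩, by rw [← Submodule.coe_smul, ← h1]⟩
  -- Kato, upgraded to the orthogonal projection onto the eigenline
  haveI : CompleteSpace (Module.End.eigenspace (T : Module.End ℝ V) l) := (isClosed_eigenspace T l).completeSpace_coe
  have hmemK : ∀ v : V, v ∈ Module.End.eigenspace (T : Module.End ℝ V) l ↔ T v = l • v := fun v => by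
    rw [Module.End.mem_eigenspace_iff]; rfl
  obtain ⟨vK, hTvK, hdistK⟩ := hkato
  obtain ⟨v, hv⟩ : ∃ v : V, v = (Module.End.eigenspace (T : Module.End ℝ V) l).starProjection x := ⟨_, rfl⟩
  obtain ⟨hvclose, hvle, -⟩ := norm_sub_starProjection_le_of_mem (𝕜 := ℝ) (Module.End.eigenspace (T : Module.End ℝ V) l) x
    ((hmemK vK).2 hTvK)
  rw [← hv] at hvclose hvle
  have hTv : T v = l • v := (hmemK v).1 (hv ▸ (Module.End.eigenspace (T : Module.End ℝ V) l).starProjection_apply_mem x)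
  have hvnorm : ‖v‖ ≤ 1 := hvle.trans hxnorm.le
  have hηnorm : ‖x - v‖ ≤ Real.sqrt (et / (β - ρhi) ^ 2) := by
    rw [← Real.sqrt_sq (norm_nonneg (x - v))]
    exact Real.sqrt_le_sqrt ((pow_le_pow_left₀ (norm_nonneg _) hvclose 2).trans hdistK)
  have hvspan : v = (inner ℝ v₀ v) • v₀ := hsimpleV v hTv
  have ha₀ : (inner ℝ v₀ v) ^ 2 ≤ 1 := by
    have h1 := abs_real_inner_le_norm v₀ v
    rw [hv₀norm, one_mul] at h1
    exact (sq_le_one_iff_abs_le_one _).2 (h1.trans hvnorm)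
  -- the whole `E` sector: `channelInf = l` and the bottom state is an eigenvector
  obtain ⟨VE, hmemVE, hVEc⟩ : ∃ VE : Submodule ℝ (Lp ℝ 2 (fermiCurveMeasure (squareDispersion 1 0) μ)),
      (∀ v, v ∈ VE ↔ P v = v) ∧ CompleteSpace VE :=
    ⟨((1 : _ →L[ℝ] _) - P).ker, fun v => kl_cb_mem_ker_iff P v, (ContinuousLinearMap.isClosed_ker _).completeSpace_coe⟩
  haveI : CompleteSpace VE := hVEc
  have hVEA : ∀ v ∈ VE, A v ∈ VE := fun v hv => by
    rw [hmemVE] at hv ⊢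
    rw [← mul_apply_eq_comp, ← hAP, mul_apply_eq_comp, hv]
  obtain ⟨TE, hTE, -, -⟩ := exists_compression A VE hVEA
  have hlE : ∃ v : VE, v ≠ 0 ∧ TE v = l • v := by
    refine ⟨⟨v₀, (hmemVE _).2 hPv₀⟩, norm_ne_zero_iff.1
      (show ‖(v₀ : Lp ℝ 2 (fermiCurveMeasure (squareDispersion 1 0) μ))‖ ≠ 0 by rw [hv₀n]; exact one_ne_zero),
      Subtype.ext ?_⟩
    rw [hTE, Submodule.coe_smul]
    exact hAv₀
  have hrayVE : ∀ y : VE, l * ‖y‖ ^ 2 ≤ inner ℝ y (TE y) := fun y => by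
    rw [(compression_inner_norm hTE y).1, Submodule.coe_norm]
    exact hrayE y ((hmemVE _).1 y.2)
  obtain ⟨-, heig⟩ := kl_nb_bottom_eigvec hμ (χ := D4Irrep.E) (withU := false) (fun h0 => (Bool.false_ne_true h0).elim)
    (Or.inr (by decide)) hmemVE
    (fun φ ψ' => by simp only [Bool.false_eq_true, ↓reduceIte, zero_add]; exact hAinner φ ψ')
    hAsa hAc hAP hPfix hPrepr hTE hlE hlρ hρhi0 hrayVE
  obtain ⟨hwfix, hwnorm, hAw⟩ := heig ψ hψs hbot hψs.1
  set w : Lp ℝ 2 (fermiCurveMeasure (squareDispersion 1 0) μ) := hψs.1.toLp ψ with hw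
  have hwae : (w : Momentum → ℝ) =ᵐ[fermiCurveMeasure (squareDispersion 1 0) μ] ψ := hψs.1.coeFn_toLp
  have hAw₂ : A (U₁ w) = l • U₁ w := by rw [← mul_apply_eq_comp, hAU, mul_apply_eq_comp, hAw, map_smul]
  -- the doublet plane: `w = α v₀ + β U₁ v₀`, `α² + β² = 1`, `v₀ = α w - β U₁ w`
  obtain ⟨α', β', hwspan⟩ := kl_nbx_span hAS hAU hSP hPU hSS hSsym hSU hUinner hneg h31 hPv₀ hsimple hwfix hAw
  have hUv₀n : ‖U₁ (v₀ : Lp ℝ 2 (fermiCurveMeasure (squareDispersion 1 0) μ))‖ = 1 := by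
    have h0 : ‖U₁ (v₀ : Lp ℝ 2 (fermiCurveMeasure (squareDispersion 1 0) μ))‖ ^ 2 = 1 := by
      rw [← real_inner_self_eq_norm_sq, hUinner, real_inner_self_eq_norm_sq, hv₀n, one_pow]
    exact (pow_eq_one_iff_of_nonneg (norm_nonneg _) two_ne_zero).1 h0
  have h01 : inner ℝ (v₀ : Lp ℝ 2 (fermiCurveMeasure (squareDispersion 1 0) μ)) (U₁ v₀) = 0 := hskew _ hPv₀
  have h10 : inner ℝ (U₁ v₀) (v₀ : Lp ℝ 2 (fermiCurveMeasure (squareDispersion 1 0) μ)) = 0 := by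
    rw [real_inner_comm]; exact h01
  have hαβ : α' ^ 2 + β' ^ 2 = 1 := by
    have h1 : ‖w‖ ^ 2 = α' ^ 2 + β' ^ 2 := by
      rw [hwspan, ← real_inner_self_eq_norm_sq, inner_add_left, inner_add_right, inner_add_right, real_inner_smul_left,
        real_inner_smul_left, real_inner_smul_left, real_inner_smul_left, real_inner_smul_right, real_inner_smul_right,
        real_inner_smul_right, real_inner_smul_right, real_inner_self_eq_norm_sq, real_inner_self_eq_norm_sq, hv₀n, hUv₀n,
        h01, h10]
      ring
    rw [← h1, hwnorm, one_pow]
  have hinv : α' • w - β' • U₁ w = (v₀ : Lp ℝ 2 (fermiCurveMeasure (squareDispersion 1 0) μ)) := by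
    have h2 : α' • w - β' • U₁ w = (α' ^ 2 + β' ^ 2) • (v₀ : Lp ℝ 2 (fermiCurveMeasure (squareDispersion 1 0) μ)) := by
      rw [hwspan, map_add, map_smul, map_smul, hrot2 _ hPv₀]
      module
    rw [h2, hαβ, one_smul]
  -- Kato's vector in the doublet basis
  obtain ⟨a, ha⟩ : ∃ a : ℝ, a = inner ℝ v₀ v * α' := ⟨_, rfl⟩
  obtain ⟨b, hb⟩ : ∃ b : ℝ, b = -(inner ℝ v₀ v * β') := ⟨_, rfl⟩
  have hvH : (v : Lp ℝ 2 (fermiCurveMeasure (squareDispersion 1 0) μ)) = a • w + b • U₁ w := by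
    rw [hvspan, Submodule.coe_smul, ← hinv, ha, hb]
    module
  have hab : a ^ 2 + b ^ 2 ≤ 1 := by
    have h1 : a ^ 2 + b ^ 2 = (inner ℝ v₀ v) ^ 2 * (α' ^ 2 + β' ^ 2) := by rw [ha, hb]; ring
    rw [h1, hαβ, mul_one]
    exact ha₀
  -- `|l| ≤ |L|`
  have hl0 : l < 0 := lt_of_le_of_lt hlρ hρhi0
  have hlL : |l| ≤ |min ((β * ρlo - ρlo ^ 2 - et) / (β - ρlo)) ((β * ρhi - ρhi ^ 2 - et) / (β - ρhi))| := by
    rw [abs_of_neg hl0, abs_of_neg (lt_of_le_of_lt hLl hl0)]; linarith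
  -- a.e. identity for `A x`
  have hsqrtN : 0 < Real.sqrt (∫ k, Φ k ^ 2 ∂fermiCurveMeasure (squareDispersion 1 0) μ) := Real.sqrt_pos.2 hN
  have hAx : (A (x : Lp ℝ 2 (fermiCurveMeasure (squareDispersion 1 0) μ)) : Momentum → ℝ)
      =ᵐ[fermiCurveMeasure (squareDispersion 1 0) μ] fun k =>
        (Real.sqrt (∫ k, Φ k ^ 2 ∂fermiCurveMeasure (squareDispersion 1 0) μ))⁻¹ *
          ∫ k', lindhardFunction (squareDispersion 1 0) μ (k + k') * Φ k' ∂fermiCurveMeasure (squareDispersion 1 0) μ := by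
    rw [hxdef, map_smul]
    filter_upwards [Lp.coeFn_smul (Real.sqrt (∫ k, Φ k ^ 2 ∂fermiCurveMeasure (squareDispersion 1 0) μ))⁻¹ (A (hΦ.toLp Φ)),
      hA (hΦ.toLp Φ)] with k hk hk'
    rw [hk, Pi.smul_apply, hk', smul_eq_mul,
      kl_bs_kernelIntegral_congr (fun q => lindhardFunction (squareDispersion 1 0) μ q) hΦ.coeFn_toLp k]
  -- the remainder lies in the block, hence in the sector
  obtain ⟨η, hη⟩ : ∃ η : Lp ℝ 2 (fermiCurveMeasure (squareDispersion 1 0) μ),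
      η = (x : Lp ℝ 2 (fermiCurveMeasure (squareDispersion 1 0) μ)) - (a • w + b • U₁ w) := ⟨_, rfl⟩
  have hηeq : η = ((x - v : V) : Lp ℝ 2 (fermiCurveMeasure (squareDispersion 1 0) μ)) := by
    rw [hη, Submodule.coe_sub, hvH]
  have hηnorm' : ‖η‖ ≤ Real.sqrt (et / (β - ρhi) ^ 2) := by rw [hηeq, Submodule.norm_coe]; exact hηnorm
  have hηfix : P η = η := by rw [hηeq]; exact ((hmemV _).1 (x - v).2).1
  obtain ⟨ψη, hchη, -, hηae⟩ := hPrepr η hηfix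
  have hκ2 : MemLp (Function.uncurry fun k q : Momentum => lindhardFunction (squareDispersion 1 0) μ (k + q)) 2
      ((fermiCurveMeasure (squareDispersion 1 0) μ).prod (fermiCurveMeasure (squareDispersion 1 0) μ)) :=
    stub_klKernelHS μ hμ
  have hrem := kl_nbs_remainder_ae hμ D4Irrep.E _ hκ2 hA hR η hchη hηae
  have hrot : MeasurePreserving rotMomentum (fermiCurveMeasure (squareDispersion 1 0) μ)
      (fermiCurveMeasure (squareDispersion 1 0) μ) := stub_klD4Invariant stub_klGradient μ hμ (DihedralGroup.r 1)
  have hw₂ae : (U₁ w : Momentum → ℝ) =ᵐ[fermiCurveMeasure (squareDispersion 1 0) μ] fun k => ψ (rotMomentum k) := by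
    filter_upwards [hU₁ae w, hrot.quasiMeasurePreserving.ae_eq hwae] with k hk hk'
    rw [hk]; exact hk'
  have hAη : (A η : Momentum → ℝ) =ᵐ[fermiCurveMeasure (squareDispersion 1 0) μ] fun k =>
      (Real.sqrt (∫ k, Φ k ^ 2 ∂fermiCurveMeasure (squareDispersion 1 0) μ))⁻¹ *
          (∫ k', lindhardFunction (squareDispersion 1 0) μ (k + k') * Φ k' ∂fermiCurveMeasure (squareDispersion 1 0) μ) -
        l * (a * ψ k + b * ψ (rotMomentum k)) := by
    have h1 : A η = A (x : Lp ℝ 2 (fermiCurveMeasure (squareDispersion 1 0) μ)) - ((l * a) • w + (l * b) • U₁ w) := by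
      rw [hη, map_sub, map_add, map_smul, map_smul, hAw, hAw₂, smul_smul, smul_smul, mul_comm a l, mul_comm b l]
    rw [h1]
    filter_upwards [Lp.coeFn_sub (A (x : Lp ℝ 2 (fermiCurveMeasure (squareDispersion 1 0) μ))) ((l * a) • w + (l * b) • U₁ w),
      Lp.coeFn_add ((l * a) • w) ((l * b) • U₁ w), Lp.coeFn_smul (l * a) w, Lp.coeFn_smul (l * b) (U₁ w), hAx, hwae, hw₂ae]
      with k hk1 hk2 hk3 hk4 hk5 hk6 hk7
    rw [hk1, Pi.sub_apply, hk2, Pi.add_apply, hk3, hk4, Pi.smul_apply, Pi.smul_apply, hk5, hk6, hk7, smul_eq_mul, smul_eq_mul]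
    ring
  -- the pointwise statement at `k`
  have hpt : ∀ᵐ k ∂fermiCurveMeasure (squareDispersion 1 0) μ,
      |∫ k', lindhardFunction (squareDispersion 1 0) μ (k + k') * Φ k' ∂fermiCurveMeasure (squareDispersion 1 0) μ| ≤
        Real.sqrt (∫ k, Φ k ^ 2 ∂fermiCurveMeasure (squareDispersion 1 0) μ) *
          (|min ((β * ρlo - ρlo ^ 2 - et) / (β - ρlo)) ((β * ρhi - ρhi ^ 2 - et) / (β - ρhi))| *
              Real.sqrt (ψ k ^ 2 + ψ (rotMomentum k) ^ 2) +
            Real.sqrt R2 * Real.sqrt (et / (β - ρhi) ^ 2)) := by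
    filter_upwards [hrem, hAη] with k hk hk'
    rw [hk'] at hk
    have h3 := (abs_sub_abs_le_abs_sub _ _).trans (hk.trans (mul_le_mul_of_nonneg_left hηnorm' (Real.sqrt_nonneg _)))
    have h4 : |l * (a * ψ k + b * ψ (rotMomentum k))| ≤
        |min ((β * ρlo - ρlo ^ 2 - et) / (β - ρlo)) ((β * ρhi - ρhi ^ 2 - et) / (β - ρhi))| *
          Real.sqrt (ψ k ^ 2 + ψ (rotMomentum k) ^ 2) := by
      rw [abs_mul]
      exact mul_le_mul hlL (kl_nb_cs_two hab) (abs_nonneg _) (abs_nonneg _)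
    rw [abs_mul, abs_of_pos (inv_pos.2 hsqrtN), ← div_eq_inv_mul, sub_le_iff_le_add, div_le_iff₀ hsqrtN] at h3
    exact h3.trans (le_of_eq_of_le (mul_comm _ _) (mul_le_mul_of_nonneg_left (by linarith [h4]) hsqrtN.le))
  -- and transported by `rot³`
  have hrot3 : MeasurePreserving (fun k => rotMomentum (rotMomentum (rotMomentum k)))
      (fermiCurveMeasure (squareDispersion 1 0) μ) (fermiCurveMeasure (squareDispersion 1 0) μ) :=
    stub_klD4Invariant stub_klGradient μ hμ (DihedralGroup.r 3)
  have hodd : ∀ k, ψ (-k) = -ψ k := (inChannel_E_iff_odd ψ).1 hψs.2.2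
  filter_upwards [hpt, hrot3.quasiMeasurePreserving.ae hpt] with k hk hk3
  refine ⟨hk, ?_⟩
  have h1 : ψ (rotMomentum (rotMomentum (rotMomentum k))) ^ 2 + ψ (rotMomentum (rotMomentum (rotMomentum (rotMomentum k)))) ^ 2 =
      ψ k ^ 2 + ψ (rotMomentum k) ^ 2 := by
    rw [kl_d4_rot_rot_rot_rot, CwKLChiralWindow.Negative.rot_rot (rotMomentum k), hodd]
    ring
  rw [h1] at hk3
  exact hk3

end Summit.HubbardSuperconductivity.HubbardSuperconductivity.Theorems

end
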